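import Mathlib
import HarnessLib
import Summits.HubbardSuperconductivity.HubbardSuperconductivity.Theorems.KLProgrammeKLRegimeTorusL1SecondDifferences

/-!
# Route `KLProgramme` — engine support (row (X).1 / located risk #14 «S3 IN U-CURRENCY», NORM side, brick (T1)): the `ℓ¹` norm of a
# space-time character sum whose symbol is a SUPERPOSITION OF SCALE BUMPS is paid by the `ℓ¹` sum of the coefficients (the dyadic total
# variation), not by the number of scales — model-free torus harmonic analysis

Cell `gate-hubbard-kl`, seat hubbard-kl-k3c2-p3 (g16; row «sector-counting import (DR2000 L11/L12) for the leg-dress bar»), for the ENGINE crux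
stmt-HubbardSuperconductivity-20437 (`KLRegimeEngineV17F2`), row (X).1 / #14 (pen g25 (R366)(iv) «(X).1-CURRENCY-BRICK», (R368), (R379)(B)): the value side of
«S3 IN U-CURRENCY» is exported (child 1: `quarticValueVariation_of_edgeClauses_explicit`, the total variation ACROSS SCALES of the quartic values is
`≤ (11/9)U + C·U²`); the norm side needs the mechanism by which an `ℓ¹` (position-space, PLAIN pinned) line is governed by such a total variation.
That mechanism is linear harmonic analysis on the space-time torus `(ℤ/P)¹ × (ℤ/L)²` and is recorded here, free of any model object:

* §1 **`sum_norm_charSum_le_of_second_differences_axes`** — the AXIS-FRAME instance of the `ℓ²` master lemma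
  `sum_norm_charSum_le_of_second_differences` (frame `v = (1,0)`, near radius `0`, one space rate): if `‖G‖ ≤ A₀`, `#{G ≠ 0} ≤ N_s`,
  `‖Δ²_{(1,0)}G‖ ≤ A₀(4/(s₀P))²` and `‖Δ²_{(0,e_i)}G‖ ≤ A₀(4/(s₁L))²`, then
  `Σ_z ‖Σ_q χ_{q₁}(z₁)χ_{q₂}(z₂)•G(q)‖ ≤ √(2048(1/s₀+1)(4(2√2/s₁+2)² + 16(1/s₁+1)²)) · √(16·P·L²·N_s) · A₀`;
* §2 **`sum_norm_charSum_bump_le`** — the SCALE-FREE form: if moreover `s₀, s₁ ≤ 1` and the support is that of a bump of rates `(s₀, s₁)`,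
  `N_s ≤ n₀·(s₀P)·(s₁L)²`, then `Σ_z ‖…‖ ≤ √(10485760·n₀) · P·L² · A₀` — the rates cancel between the decay volume and the support count
  (a smooth bump at ANY scale has normalised `ℓ¹` norm `O(1)`: `‖χ̌_Λ‖_{L¹}` is scale invariant);
* §3 `charSum_sum_mul_eq`, **`sum_norm_charSum_sum_mul_le`** — linearity of the character sum in the symbol and the triangle inequality:
  `Σ_z ‖S[Σ_s a_s G_s](z)‖ ≤ Σ_s ‖a_s‖ · Σ_z ‖S[G_s](z)‖`;
* §4 **`sum_norm_charSum_superposition_le`** — assembled: for a finite family of bumps `G_s` (rates `(s₀ˢ, s₁ˢ) ∈ (0,1]²`, sizes `A_s`, supports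
  `≤ n₀ s₀ˢP(s₁ˢL)²`) and coefficients `a_s`, `Σ_z ‖S[Σ_s a_s G_s](z)‖ ≤ √(10485760·n₀) · P·L² · Σ_s ‖a_s‖·A_s`.  With cumulative cutoffs
  `G_s = χ_{≤ s}` and `a_s = u(s+1) − u(s)` the right side is the DYADIC TOTAL VARIATION `Σ_s |u(s+1) − u(s)|` of the profile `u` — whereas
  `Σ_s sup = Σ_s |u(s)|` would grow with the number of scales (`ε`-currency `U + U²·j` versus `U`-currency, HOME/hubbard-kl-k3c2-p3/X-CURRENCY-IMPORTSIDE.md (★)).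

Everything is proved; no definitions, no named facts; nothing here asserts any engine row, (X).1, a branch, K3 or superconductivity. [folklore]

References: G. Benfatto, A. Giuliani, V. Mastropietro, Ann. Henri Poincaré 7 (2006) 809–898, §2.8 (2.81) and footnote ¹ (the `ℓ²` route);
Y. Katznelson, *An Introduction to Harmonic Analysis*, 3rd ed., Ch. I §6 (Bernstein: `A(𝕋)` norms of smooth bumps); A. Zygmund, *Trigonometric Series* I, Ch. VI §3.
-/

noncomputable section

namespace Summit.HubbardSuperconductivity.HubbardSuperconductivity.Theorems.TorusFourierL2

set_option linter.dupNamespace false -- summit = problem name (single-conjunct summit), D-0017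

open Finset Complex Literature.Probability.LatticeModels
open scoped Real

variable {P L : ℕ} [NeZero P] [NeZero L]

/-! ### §1 The axis-frame instance of the master lemma -/

/-- **The `ℓ¹` norm of a space-time character sum from sup, support and the second differences along the time axis and the two space
axes** (frame `v = (1,0)`, near radius `0`): `Σ_z ‖Σ_q χ_{q₁}(z₁)χ_{q₂}(z₂)•G(q)‖ ≤ √(2048(1/s₀+1)(4(2√2/s₁+2)² + 16(1/s₁+1)²))·√(16PL²N_s)·A₀`.
[cite: BenfattoGiulianiMastropietro2006, §2.8 (2.81) and footnote 1] -/
theorem sum_norm_charSum_le_of_second_differences_axes (G : TorusSite 1 P × TorusSite 2 L → ℂ)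
    {s₀ s₁ : ℝ} (hs₀ : 0 < s₀) (hs₁ : 0 < s₁) {A₀ : ℝ} (hA₀ : 0 ≤ A₀) {Ns : ℕ}
    (hsupp : (univ.filter fun q => G q ≠ 0).card ≤ Ns) (hsup : ∀ q, ‖G q‖ ≤ A₀)
    (h₀ : ∀ q, ‖(fwdDiff ((fun _ : Fin 1 => (1 : ZMod P)), (0 : TorusSite 2 L)))^[2] G q‖ ≤ A₀ * (4 / (s₀ * P)) ^ 2)
    (h₁ : ∀ q (i : Fin 2), ‖(fwdDiff ((0 : TorusSite 1 P), (Pi.single i (1 : ZMod L) : TorusSite 2 L)))^[2] G q‖ ≤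
      A₀ * (4 / (s₁ * L)) ^ 2) :
    ∑ z : TorusSite 1 P × TorusSite 2 L, ‖∑ q : TorusSite 1 P × TorusSite 2 L, (torusChar q.1 z.1 * torusChar q.2 z.2) • G q‖ ≤
      Real.sqrt (2048 * (1 / s₀ + 1) * (4 * (2 * Real.sqrt 2 / s₁ + 2) ^ 2 + 16 * (1 / s₁ + 1) ^ 2)) *
        Real.sqrt (16 * P * (L : ℝ) ^ 2 * Ns) * A₀ := by
  classical
  have hv : (![1, 0] : Fin 2 → ℤ) ≠ 0 := by
    intro h; have := congrFun h 0; simp at this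
  have hL : (0 : ℤ) < L := by exact_mod_cast Nat.pos_of_ne_zero (NeZero.ne L)
  have hR₀ : 2 * (|(![1, 0] : Fin 2 → ℤ) 0| + |(![1, 0] : Fin 2 → ℤ) 1|) * ((0 : ℕ) : ℤ) < L := by simpa using hL
  have hdir2 : (fun j => ((![-(![1, 0] : Fin 2 → ℤ) 1, (![1, 0] : Fin 2 → ℤ) 0] j : ℤ) : ZMod L)) =
      (Pi.single 1 (1 : ZMod L) : TorusSite 2 L) := by
    funext j; fin_cases j <;> simp
  have hdir3 : (fun j => (((![1, 0] : Fin 2 → ℤ) j : ℤ) : ZMod L)) = (Pi.single 0 (1 : ZMod L) : TorusSite 2 L) := by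
    funext j; fin_cases j <;> simp
  have h₂ : ∀ q, ‖(fwdDiff ((0 : TorusSite 1 P),
      (fun j => ((![-(![1, 0] : Fin 2 → ℤ) 1, (![1, 0] : Fin 2 → ℤ) 0] j : ℤ) : ZMod L))))^[2] G q‖ ≤ A₀ * (4 / (s₁ * L)) ^ 2 :=
    fun q => by rw [hdir2]; exact h₁ q 1
  have h₃ : ∀ q, ‖(fwdDiff ((0 : TorusSite 1 P), (fun j => (((![1, 0] : Fin 2 → ℤ) j : ℤ) : ZMod L))))^[2] G q‖ ≤
      A₀ * (4 / (s₁ * L)) ^ 2 := fun q => by rw [hdir3]; exact h₁ q 0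
  have hmain := sum_norm_charSum_le_of_second_differences G (![1, 0]) hv hs₀ hs₁ hs₁ hs₁ hR₀ hA₀ hsupp hsup h₀ h₁ h₂ h₃
  refine hmain.trans (le_of_eq ?_)
  have hsq : Real.sqrt ((((![1, 0] : Fin 2 → ℤ) 0 : ℤ) : ℝ) ^ 2 + (((![1, 0] : Fin 2 → ℤ) 1 : ℤ) : ℝ) ^ 2) = 1 := by simp
  rw [hsq]
  congr 2
  congr 1
  push_cast
  ring

/-! ### §2 The scale-free form: a bump at any scale has normalised `ℓ¹` norm `O(1)` -/

/-- `(2√2 + 2)² ≤ 24`. [folklore] -/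
theorem two_sqrt_two_add_two_sq_le : (2 * Real.sqrt 2 + 2) ^ 2 ≤ 24 := by
  have h2 : Real.sqrt 2 ^ 2 = 2 := Real.sq_sqrt (by norm_num)
  have hs : Real.sqrt 2 ≤ 3 / 2 := by
    rw [show (3 / 2 : ℝ) = Real.sqrt ((3 / 2) ^ 2) by rw [Real.sqrt_sq (by norm_num)]]
    exact Real.sqrt_le_sqrt (by norm_num)
  nlinarith [Real.sqrt_nonneg 2]

omit [NeZero P] [NeZero L] in
/-- The rate bookkeeping: for `0 < s₀, s₁ ≤ 1`,
`2048(1/s₀+1)(4(2√2/s₁+2)² + 16(1/s₁+1)²) · (16·P·L²·N_s) ≤ 10485760·n₀·(P·L²)²` as soon as `N_s ≤ n₀·(s₀P)(s₁L)²`. [folklore] -/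
theorem rate_bookkeeping_le {s₀ s₁ : ℝ} (hs₀ : 0 < s₀) (hs₀1 : s₀ ≤ 1) (hs₁ : 0 < s₁) (hs₁1 : s₁ ≤ 1)
    {n₀ : ℝ} {Ns : ℕ} (hNs : (Ns : ℝ) ≤ n₀ * (s₀ * P) * (s₁ * L) ^ 2) :
    2048 * (1 / s₀ + 1) * (4 * (2 * Real.sqrt 2 / s₁ + 2) ^ 2 + 16 * (1 / s₁ + 1) ^ 2) * (16 * P * (L : ℝ) ^ 2 * Ns) ≤
      10485760 * n₀ * ((P : ℝ) * (L : ℝ) ^ 2) ^ 2 := by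
  have hP : (0 : ℝ) ≤ P := Nat.cast_nonneg _
  have hL : (0 : ℝ) ≤ L := Nat.cast_nonneg _
  -- `1/s + 1 ≤ 2/s` and `2√2/s₁ + 2 ≤ (2√2+2)/s₁` for rates `≤ 1`
  have ha : 1 / s₀ + 1 ≤ 2 / s₀ := by
    rw [div_add_one (ne_of_gt hs₀), div_le_div_iff_of_pos_right hs₀]; linarith
  have hb : 2 * Real.sqrt 2 / s₁ + 2 ≤ (2 * Real.sqrt 2 + 2) / s₁ := by
    rw [add_div, add_le_add_iff_left, le_div_iff₀ hs₁]; nlinarith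
  have hb0 : 0 ≤ 2 * Real.sqrt 2 / s₁ + 2 := by positivity
  have hb2 : (2 * Real.sqrt 2 / s₁ + 2) ^ 2 ≤ 24 / s₁ ^ 2 := by
    calc (2 * Real.sqrt 2 / s₁ + 2) ^ 2 ≤ ((2 * Real.sqrt 2 + 2) / s₁) ^ 2 := pow_le_pow_left₀ hb0 hb 2
      _ = (2 * Real.sqrt 2 + 2) ^ 2 / s₁ ^ 2 := by rw [div_pow]
      _ ≤ 24 / s₁ ^ 2 := div_le_div_of_nonneg_right two_sqrt_two_add_two_sq_le (by positivity)
  have hc : 1 / s₁ + 1 ≤ 2 / s₁ := by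
    rw [div_add_one (ne_of_gt hs₁), div_le_div_iff_of_pos_right hs₁]; linarith
  have hc0 : 0 ≤ 1 / s₁ + 1 := by positivity
  have hc2 : (1 / s₁ + 1) ^ 2 ≤ 4 / s₁ ^ 2 := by
    calc (1 / s₁ + 1) ^ 2 ≤ (2 / s₁) ^ 2 := pow_le_pow_left₀ hc0 hc 2
      _ = 4 / s₁ ^ 2 := by rw [div_pow]; norm_num
  have hK : 2048 * (1 / s₀ + 1) * (4 * (2 * Real.sqrt 2 / s₁ + 2) ^ 2 + 16 * (1 / s₁ + 1) ^ 2) ≤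
      2048 * (2 / s₀) * (160 / s₁ ^ 2) := by
    have h1 : 4 * (2 * Real.sqrt 2 / s₁ + 2) ^ 2 + 16 * (1 / s₁ + 1) ^ 2 ≤ 160 / s₁ ^ 2 := by
      have := add_le_add (mul_le_mul_of_nonneg_left hb2 (by norm_num : (0:ℝ) ≤ 4))
        (mul_le_mul_of_nonneg_left hc2 (by norm_num : (0:ℝ) ≤ 16))
      refine this.trans (le_of_eq ?_); ring
    have h0 : 0 ≤ 4 * (2 * Real.sqrt 2 / s₁ + 2) ^ 2 + 16 * (1 / s₁ + 1) ^ 2 := by positivity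
    calc 2048 * (1 / s₀ + 1) * (4 * (2 * Real.sqrt 2 / s₁ + 2) ^ 2 + 16 * (1 / s₁ + 1) ^ 2)
        ≤ 2048 * (2 / s₀) * (4 * (2 * Real.sqrt 2 / s₁ + 2) ^ 2 + 16 * (1 / s₁ + 1) ^ 2) :=
          mul_le_mul_of_nonneg_right (mul_le_mul_of_nonneg_left ha (by norm_num)) h0
      _ ≤ 2048 * (2 / s₀) * (160 / s₁ ^ 2) := mul_le_mul_of_nonneg_left h1 (by positivity)
  have hN : 16 * P * (L : ℝ) ^ 2 * Ns ≤ 16 * P * (L : ℝ) ^ 2 * (n₀ * (s₀ * P) * (s₁ * L) ^ 2) :=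
    mul_le_mul_of_nonneg_left hNs (by positivity)
  have hK0 : 0 ≤ 2048 * (1 / s₀ + 1) * (4 * (2 * Real.sqrt 2 / s₁ + 2) ^ 2 + 16 * (1 / s₁ + 1) ^ 2) := by positivity
  have hN0 : 0 ≤ 16 * P * (L : ℝ) ^ 2 * Ns := by positivity
  calc _ ≤ 2048 * (2 / s₀) * (160 / s₁ ^ 2) * (16 * P * (L : ℝ) ^ 2 * (n₀ * (s₀ * P) * (s₁ * L) ^ 2)) :=
        mul_le_mul hK hN hN0 ((hK0.trans hK))
    _ = 10485760 * n₀ * ((P : ℝ) * (L : ℝ) ^ 2) ^ 2 := by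
        field_simp
        ring

/-- **A bump at any scale has normalised `ℓ¹` norm `O(1)`**: under the hypotheses of `sum_norm_charSum_le_of_second_differences_axes` with rates
`s₀, s₁ ∈ (0, 1]` and a support count of bump type `N_s ≤ n₀·(s₀P)·(s₁L)²`,
`Σ_z ‖Σ_q χ_{q₁}(z₁)χ_{q₂}(z₂)•G(q)‖ ≤ √(10485760·n₀) · (P·L²) · A₀` — no rate survives. [cite: Katznelson2004, Ch. I §6.3] -/
theorem sum_norm_charSum_bump_le (G : TorusSite 1 P × TorusSite 2 L → ℂ)
    {s₀ s₁ : ℝ} (hs₀ : 0 < s₀) (hs₀1 : s₀ ≤ 1) (hs₁ : 0 < s₁) (hs₁1 : s₁ ≤ 1) {A₀ : ℝ} (hA₀ : 0 ≤ A₀) {Ns : ℕ} {n₀ : ℝ}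
    (hn₀ : 0 ≤ n₀) (hNs : (Ns : ℝ) ≤ n₀ * (s₀ * P) * (s₁ * L) ^ 2)
    (hsupp : (univ.filter fun q => G q ≠ 0).card ≤ Ns) (hsup : ∀ q, ‖G q‖ ≤ A₀)
    (h₀ : ∀ q, ‖(fwdDiff ((fun _ : Fin 1 => (1 : ZMod P)), (0 : TorusSite 2 L)))^[2] G q‖ ≤ A₀ * (4 / (s₀ * P)) ^ 2)
    (h₁ : ∀ q (i : Fin 2), ‖(fwdDiff ((0 : TorusSite 1 P), (Pi.single i (1 : ZMod L) : TorusSite 2 L)))^[2] G q‖ ≤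
      A₀ * (4 / (s₁ * L)) ^ 2) :
    ∑ z : TorusSite 1 P × TorusSite 2 L, ‖∑ q : TorusSite 1 P × TorusSite 2 L, (torusChar q.1 z.1 * torusChar q.2 z.2) • G q‖ ≤
      Real.sqrt (10485760 * n₀) * ((P : ℝ) * (L : ℝ) ^ 2) * A₀ := by
  refine (sum_norm_charSum_le_of_second_differences_axes G hs₀ hs₁ hA₀ hsupp hsup h₀ h₁).trans ?_
  have hPL : 0 ≤ (P : ℝ) * (L : ℝ) ^ 2 := by positivity
  have hK0 : 0 ≤ 2048 * (1 / s₀ + 1) * (4 * (2 * Real.sqrt 2 / s₁ + 2) ^ 2 + 16 * (1 / s₁ + 1) ^ 2) := by positivity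
  have hkey : Real.sqrt (2048 * (1 / s₀ + 1) * (4 * (2 * Real.sqrt 2 / s₁ + 2) ^ 2 + 16 * (1 / s₁ + 1) ^ 2)) *
      Real.sqrt (16 * P * (L : ℝ) ^ 2 * Ns) ≤ Real.sqrt (10485760 * n₀) * ((P : ℝ) * (L : ℝ) ^ 2) := by
    have h1 : Real.sqrt (10485760 * n₀) * ((P : ℝ) * (L : ℝ) ^ 2) = Real.sqrt (10485760 * n₀ * ((P : ℝ) * (L : ℝ) ^ 2) ^ 2) := by
      rw [Real.sqrt_mul (by positivity : (0 : ℝ) ≤ 10485760 * n₀) (((P : ℝ) * (L : ℝ) ^ 2) ^ 2), Real.sqrt_sq hPL]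
    rw [← Real.sqrt_mul hK0, h1]
    exact Real.sqrt_le_sqrt (rate_bookkeeping_le hs₀ hs₀1 hs₁ hs₁1 hNs)
  exact mul_le_mul_of_nonneg_right hkey hA₀

/-! ### §3 Linearity of the character sum in the symbol -/

/-- The character sum of a finite linear combination of symbols is the linear combination of the character sums. [folklore] -/
theorem charSum_sum_mul_eq {ι : Type*} (S : Finset ι) (a : ι → ℂ) (G : ι → TorusSite 1 P × TorusSite 2 L → ℂ)
    (z : TorusSite 1 P × TorusSite 2 L) :
    ∑ q : TorusSite 1 P × TorusSite 2 L, (torusChar q.1 z.1 * torusChar q.2 z.2) • (∑ s ∈ S, a s * G s q) =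
      ∑ s ∈ S, a s * ∑ q : TorusSite 1 P × TorusSite 2 L, (torusChar q.1 z.1 * torusChar q.2 z.2) • G s q := by
  simp only [smul_eq_mul, mul_sum]
  rw [sum_comm]
  refine sum_congr rfl fun s _ => sum_congr rfl fun q _ => ?_
  ring

/-- **Triangle inequality for superpositions**: `Σ_z ‖S[Σ_s a_s G_s](z)‖ ≤ Σ_s ‖a_s‖ · Σ_z ‖S[G_s](z)‖`. [folklore] -/
theorem sum_norm_charSum_sum_mul_le {ι : Type*} (S : Finset ι) (a : ι → ℂ) (G : ι → TorusSite 1 P × TorusSite 2 L → ℂ) :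
    ∑ z : TorusSite 1 P × TorusSite 2 L,
        ‖∑ q : TorusSite 1 P × TorusSite 2 L, (torusChar q.1 z.1 * torusChar q.2 z.2) • (∑ s ∈ S, a s * G s q)‖ ≤
      ∑ s ∈ S, ‖a s‖ * ∑ z : TorusSite 1 P × TorusSite 2 L,
        ‖∑ q : TorusSite 1 P × TorusSite 2 L, (torusChar q.1 z.1 * torusChar q.2 z.2) • G s q‖ := by
  calc _ = ∑ z : TorusSite 1 P × TorusSite 2 L,
        ‖∑ s ∈ S, a s * ∑ q : TorusSite 1 P × TorusSite 2 L, (torusChar q.1 z.1 * torusChar q.2 z.2) • G s q‖ := by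
          refine sum_congr rfl fun z _ => ?_; rw [charSum_sum_mul_eq]
    _ ≤ ∑ z : TorusSite 1 P × TorusSite 2 L,
        ∑ s ∈ S, ‖a s‖ * ‖∑ q : TorusSite 1 P × TorusSite 2 L, (torusChar q.1 z.1 * torusChar q.2 z.2) • G s q‖ := by
          refine sum_le_sum fun z _ => (norm_sum_le _ _).trans (le_of_eq ?_)
          exact sum_congr rfl fun s _ => norm_mul _ _
    _ = _ := by rw [sum_comm]; exact sum_congr rfl fun s _ => by rw [mul_sum]

/-! ### §4 The assembled dyadic-superposition bound -/

/-- **The `ℓ¹` norm of a superposition of scale bumps is paid by the `ℓ¹` sum of its coefficients** (the dyadic total variation): for a finite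
family `G_s` of bumps with rates `(s₀ˢ, s₁ˢ) ∈ (0,1]²`, sizes `A_s ≥ 0`, supports `≤ n₀·s₀ˢP·(s₁ˢL)²`, and coefficients `a_s`,
`Σ_z ‖S[Σ_s a_s G_s](z)‖ ≤ √(10485760·n₀) · (P·L²) · Σ_s ‖a_s‖·A_s`. [cite: Katznelson2004, Ch. I §6.3] -/
theorem sum_norm_charSum_superposition_le {ι : Type*} (S : Finset ι) (a : ι → ℂ) (G : ι → TorusSite 1 P × TorusSite 2 L → ℂ)
    (s₀ s₁ A : ι → ℝ) (Ns : ι → ℕ) {n₀ : ℝ} (hn₀ : 0 ≤ n₀)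
    (hs₀ : ∀ s ∈ S, 0 < s₀ s) (hs₀1 : ∀ s ∈ S, s₀ s ≤ 1) (hs₁ : ∀ s ∈ S, 0 < s₁ s) (hs₁1 : ∀ s ∈ S, s₁ s ≤ 1)
    (hA : ∀ s ∈ S, 0 ≤ A s) (hNs : ∀ s ∈ S, (Ns s : ℝ) ≤ n₀ * (s₀ s * P) * (s₁ s * L) ^ 2)
    (hsupp : ∀ s ∈ S, (univ.filter fun q => G s q ≠ 0).card ≤ Ns s) (hsup : ∀ s ∈ S, ∀ q, ‖G s q‖ ≤ A s)
    (h₀ : ∀ s ∈ S, ∀ q, ‖(fwdDiff ((fun _ : Fin 1 => (1 : ZMod P)), (0 : TorusSite 2 L)))^[2] (G s) q‖ ≤ A s * (4 / (s₀ s * P)) ^ 2)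
    (h₁ : ∀ s ∈ S, ∀ q (i : Fin 2), ‖(fwdDiff ((0 : TorusSite 1 P), (Pi.single i (1 : ZMod L) : TorusSite 2 L)))^[2] (G s) q‖ ≤
      A s * (4 / (s₁ s * L)) ^ 2) :
    ∑ z : TorusSite 1 P × TorusSite 2 L,
        ‖∑ q : TorusSite 1 P × TorusSite 2 L, (torusChar q.1 z.1 * torusChar q.2 z.2) • (∑ s ∈ S, a s * G s q)‖ ≤
      Real.sqrt (10485760 * n₀) * ((P : ℝ) * (L : ℝ) ^ 2) * ∑ s ∈ S, ‖a s‖ * A s := by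
  refine (sum_norm_charSum_sum_mul_le S a G).trans ?_
  rw [mul_sum]
  refine sum_le_sum fun s hs => ?_
  have hb := sum_norm_charSum_bump_le (G s) (hs₀ s hs) (hs₀1 s hs) (hs₁ s hs) (hs₁1 s hs) (hA s hs) hn₀ (hNs s hs)
    (hsupp s hs) (hsup s hs) (h₀ s hs) (h₁ s hs)
  calc ‖a s‖ * ∑ z : TorusSite 1 P × TorusSite 2 L, ‖∑ q, (torusChar q.1 z.1 * torusChar q.2 z.2) • G s q‖
      ≤ ‖a s‖ * (Real.sqrt (10485760 * n₀) * ((P : ℝ) * (L : ℝ) ^ 2) * A s) := mul_le_mul_of_nonneg_left hb (norm_nonneg _)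
    _ = Real.sqrt (10485760 * n₀) * ((P : ℝ) * (L : ℝ) ^ 2) * (‖a s‖ * A s) := by ring

end Summit.HubbardSuperconductivity.HubbardSuperconductivity.Theorems.TorusFourierL2

end
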